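import Mathlib.Probability.Independence.ZeroOne
import Summits.Ventures.PercRepro0.Invariance
import Summits.Ventures.PercRepro0.Independence

/-! # L5 in Lean: the zero–one law for the existence of an infinite cluster (p5)

ROUTE-v3/v4 L5 (GLUE-p2 L5), formalised on `Defs.lean`:

* `conn_sdiff_of_conn`: if `x ↔ y` in `ω` then, after removing the bonds of a set `F`, `y` is still joined to `x`
  or to an endpoint of a removed bond; hence `existsInfCluster_sdiff_finite`: the existence of an infinite cluster
  is unchanged by closing finitely many bonds;
* `measurable_sdiff_sigmaOn`: `ω ↦ ω \ F` is measurable for the σ-algebra `F_E` of the bonds outside `F`;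
  therefore `{∃ infinite cluster}` is `F_E`-measurable for every cofinite `E` (`existsInfCluster_measurableSet_sigmaOn`),
  i.e. it is a tail event;
* Kolmogorov's 0–1 law (Mathlib's `measure_zero_or_one_of_measurableSet_limsup` with the cofinite filter and the
  independent coordinate σ-algebras of `Independence.lean`) gives `P_existsInfCluster_zero_or_one`;
* with translation invariance (`Invariance.lean`): `P_p(∃ infinite cluster) = 1 ↔ θ_d(p) > 0`
  (`P_existsInfCluster_eq_one_iff`), so `L5_ZeroOne_holds : L5_ZeroOne d`.
-/

namespace Summit.Ventures.PercRepro0.Defs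

open MeasureTheory ProbabilityTheory unitInterval Set Filter
open scoped ENNReal

section SdiffMeasurable

variable {ι : Type*}

/-- Closing the bonds of `F` is measurable for the σ-algebra of the bonds outside `F`. -/
theorem measurable_sdiff_sigmaOn {F : Set ι} (E : Set ι) (hEF : ∀ a, a ∉ F → a ∈ E) :
    @Measurable (Set ι) (Set ι) (sigmaOn E) _ (fun ω => ω \ F) := by
  refine (@measurable_set_iff _ _ (sigmaOn E) (fun ω => ω \ F)).2 fun a => ?_
  by_cases ha : a ∈ F
  · have h : (fun ω : Set ι => a ∈ ω \ F) = fun _ => False := by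
      funext ω
      simp [ha]
    rw [h]
    exact measurable_const
  · have h : (fun ω : Set ι => a ∈ ω \ F) = fun ω => a ∈ ω := by
      funext ω
      simp [ha]
    rw [h]
    exact Measurable.of_comap_le (le_iSup₂ (f := fun e (_ : e ∈ E) => coordSigma e) a (hEF a ha))

end SdiffMeasurable

variable {d : ℕ}

/-- After removing the bonds of `F`, every vertex of the cluster of `x` is joined to `x` or to an endpoint of a
removed bond. -/
theorem conn_sdiff_of_conn {ω : Config d} {F : Set (Sym2 (Vertex d))} {x y : Vertex d}
    (h : Conn d ω x y) :
    Conn d (ω \ F) x y ∨ ∃ e ∈ F, ∃ v ∈ e, Conn d (ω \ F) v y := by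
  obtain ⟨w⟩ := h
  induction w with
  | nil => exact Or.inl (SimpleGraph.Reachable.refl _)
  | @cons a b c hab _ ih =>
    rcases ih with h | ⟨e, he, v, hv, hc⟩
    · by_cases hF : s(a, b) ∈ F
      · exact Or.inr ⟨s(a, b), hF, b, Sym2.mem_mk_right a b, h⟩
      · refine Or.inl ((SimpleGraph.Adj.reachable ?_).trans h)
        rw [openGraph, SimpleGraph.fromEdgeSet_adj] at hab ⊢
        exact ⟨⟨⟨hab.1.1, hF⟩, hab.1.2⟩, hab.2⟩
    · exact Or.inr ⟨e, he, v, hv, hc⟩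

/-- The endpoints of a bond form a finite set. -/
theorem finite_mem_sym2 (e : Sym2 (Vertex d)) : {v : Vertex d | v ∈ e}.Finite := by
  induction e using Sym2.ind with
  | h a b =>
    refine (Set.toFinite {a, b}).subset fun v hv => ?_
    rcases Sym2.mem_iff.1 hv with rfl | rfl
    · exact Set.mem_insert _ _
    · exact Set.mem_insert_of_mem _ (Set.mem_singleton _)

/-- Closing finitely many bonds does not change whether an infinite cluster exists. -/
theorem existsInfCluster_sdiff_finite {ω : Config d} {F : Set (Sym2 (Vertex d))} (hF : F.Finite) :
    ω ∈ existsInfCluster d ↔ ω \ F ∈ existsInfCluster d := by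
  constructor
  · rintro ⟨x, hx⟩
    let V : Set (Vertex d) := insert x (⋃ e ∈ F, {v | v ∈ e})
    have hV : V.Finite := (hF.biUnion fun e _ => finite_mem_sym2 e).insert x
    have hsub : cluster d ω x ⊆ ⋃ v ∈ V, cluster d (ω \ F) v := by
      intro y hy
      rcases conn_sdiff_of_conn hy with h | ⟨e, he, v, hv, hc⟩
      · exact Set.mem_biUnion (Set.mem_insert x _) h
      · exact Set.mem_biUnion (Set.mem_insert_of_mem x (Set.mem_biUnion he hv)) hc
    by_contra hcon
    apply hx
    refine (Set.Finite.biUnion hV fun v _ => ?_).subset hsub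
    exact Set.not_infinite.1 fun hinf => hcon ⟨v, hinf⟩
  · rintro ⟨x, hx⟩
    exact ⟨x, connInf_mono Set.sdiff_subset hx⟩

/-- `{∃ infinite cluster}` is measurable for the σ-algebra of the bonds of any cofinite set `E`: a tail event. -/
theorem existsInfCluster_measurableSet_sigmaOn {E : Set (Sym2 (Vertex d))} (hE : Eᶜ.Finite) :
    MeasurableSet[sigmaOn E] (existsInfCluster d) := by
  have hpre : existsInfCluster d = (fun ω : Config d => ω \ Eᶜ) ⁻¹' existsInfCluster d := by
    ext ω
    exact existsInfCluster_sdiff_finite hE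
  rw [hpre]
  exact measurable_sdiff_sigmaOn E (fun a ha => Set.notMem_compl_iff.1 ha)
    measurableSet_existsInfCluster

/-- Kolmogorov: `P_p(∃ infinite cluster) ∈ {0, 1}`. -/
theorem P_existsInfCluster_zero_or_one (p : I) :
    P d p (existsInfCluster d) = 0 ∨ P d p (existsInfCluster d) = 1 := by
  refine measure_zero_or_one_of_measurableSet_limsup (s := coordSigma) (f := Filter.cofinite)
    (p := fun t : Set (Sym2 (Vertex d)) => t.Finite)
    (ns := fun s : Finset (Sym2 (Vertex d)) => (↑s : Set (Sym2 (Vertex d))))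
    (fun e => coordSigma_le e) (iIndep_coordSigma (bonds d) p) ?_ ?_ ?_ ?_ ?_
  · intro t ht
    exact ht.compl_mem_cofinite
  · intro s t
    exact ⟨s ∪ t, by simp, by simp⟩
  · intro s
    exact s.finite_toSet
  · intro e
    exact ⟨{e}, by simp⟩
  · rw [Filter.limsup_eq_iInf_iSup, MeasurableSpace.measurableSet_iInf]
    intro t
    rw [MeasurableSpace.measurableSet_iInf]
    intro ht
    exact existsInfCluster_measurableSet_sigmaOn (Filter.mem_cofinite.1 ht)

/-- `{∃ infinite cluster}` is the union of the translates of `{0 ↔ ∞}`. -/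
theorem existsInfCluster_eq_iUnion :
    existsInfCluster d = ⋃ x : Vertex d, {ω : Config d | ConnInf d ω x} := by
  ext ω
  simp [existsInfCluster]

/-- If `θ_d(p) = 0` then a.s. there is no infinite cluster (countable union of null translates). -/
theorem P_existsInfCluster_eq_zero_of_thetaI (p : I) (h : thetaI d p = 0) :
    P d p (existsInfCluster d) = 0 := by
  have hP0 : P d p (percolates d) = 0 := by
    rcases (ENNReal.toReal_eq_zero_iff _).1 h with h0 | htop
    · exact h0
    · exact absurd htop (measure_ne_top _ _)
  rw [existsInfCluster_eq_iUnion]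
  refine measure_iUnion_null fun x => ?_
  rw [← preimage_shiftConfig_percolates x, P_shiftConfig_preimage x p measurableSet_percolates, hP0]

/-- `P_p(∃ infinite cluster) = 1 ↔ θ_d(p) > 0`. -/
theorem P_existsInfCluster_eq_one_iff (p : I) :
    P d p (existsInfCluster d) = 1 ↔ 0 < thetaI d p := by
  constructor
  · intro h1
    by_contra h0
    have hθ : thetaI d p = 0 := le_antisymm (not_lt.1 h0) (thetaI_nonneg d p)
    rw [P_existsInfCluster_eq_zero_of_thetaI p hθ] at h1
    exact zero_ne_one h1
  · intro hθ
    rcases P_existsInfCluster_zero_or_one p with h0 | h1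
    · exfalso
      have hle : P d p (percolates d) ≤ P d p (existsInfCluster d) :=
        measure_mono fun ω hω => ⟨0, hω⟩
      rw [h0] at hle
      have hP : P d p (percolates d) = 0 := le_antisymm hle bot_le
      have hθ0 : thetaI d p = 0 := by
        unfold thetaI
        rw [hP]
        simp
      rw [hθ0] at hθ
      exact lt_irrefl 0 hθ
    · exact h1

/-- L5 · ZERO-ONE holds. -/
theorem L5_ZeroOne_holds (d : ℕ) : L5_ZeroOne d :=
  fun p => ⟨P_existsInfCluster_zero_or_one p, P_existsInfCluster_eq_one_iff p⟩

end Summit.Ventures.PercRepro0.Defs
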